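import Summits.BirchSwinnertonDyer.BirchSwinnertonDyer.Theorems.SylvesterTwoHeegnerIndexCoupledTelescopePairFlipPrep
import Summits.BirchSwinnertonDyer.BirchSwinnertonDyer.Theorems.SylvesterTwoHeegnerIndexCMDataClassInvariance
import Summits.BirchSwinnertonDyer.BirchSwinnertonDyer.Theorems.SylvesterTwoHeegnerIndexCoupledTelescopeFrobFix
import HarnessLib

/-!
# The COUPLED Cassels–Tate telescope, XXXVIII: the FLIP WITH MULTIPLES between two LEVELS `9pm ⊂ 9p(ℓm)` of
# the (T-L1) class system (RESIDUE c v3 l.87–98; crux `UpperOffV0HSYPlus`, stmt-BirchSwinnertonDyer-19804)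

The FLIP core `flip_core_sylvesterTower` ((T9), `…CoupledTelescopeFlipCore`) is stated for two points `z, z₀` at
ONE level `K[9p(ℓm)]` with displayed Euler-system inputs.  The rows' class term `c_X(n)` is built at ITS OWN
level `K[9pn]` (fixer `N_n`, coherent embedding `emb_n`, derived point `D_{l_n} y_n` along a list `l_n` of
generators).  This file bridges the two: for the pair of levels `m ∣ ℓm` with COHERENT embeddings
(`emb_{ℓm} ∘ incl = emb_m`) and COMPATIBLE generators (`σ_q^{(ℓm)} ∘ incl = incl ∘ σ_q^{(m)}`, (T15)), the
top list a permutation of `(σ_ℓ, ℓ) :: lift(l_m)`: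
* ★ `pairFlip_core_sylvesterTower` — for the two cubic twists `E_{b₁}` (upper, family `ρ`) and `E_{b₂}` (lower,
  family `ρ' = ρ²`): `k • c(ψ₁(D_{l_{ℓm}} y_{ℓm})^{χ₁})` (class w.r.t. `N_{ℓm}`) is Selmer at `λ ∋ ℓ` iff
  `k • c(ψ₂(D_{l_m} y_m)^{χ₂})` (class w.r.t. `N_m`) lies in `T(λ)` — from the core with `z := D_{lift l_m} y_{ℓm}`,
  `z₀ := (D_{l_m} y_m)↑`: `htrz` by (T12), `hES` by #20 pushed through `lift l_m` (`…PairFlipPrep`), `hPmFrob` by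
  (T11), the lower class read at the top module by `kolyvaginClass_mono`.
Theorems only (no definition / named fact / instance / notation); nothing asserted on 19804; no stub closed;
X12.CMAtTwo NOT proved; BSD not claimed for any curve.  Sources: [GrossLMS1991] §3 (3.5), Prop. 3.7, §4, Prop. 6.2;
[McCallumLMS1991] Prop. 4.4, §4 (4)–(6); [Nekovar2007] Prop. 4.9; [HuShuYin2019] §2, §4.1.
`lean search 'pairFlip'` → nothing before this file.
-/

set_option linter.dupNamespace false -- Summits modules are `Summit.<Summit>.<Problem>…` by design
set_option autoImplicit false

noncomputable section

open scoped Classical Pointwise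

namespace Summit.BirchSwinnertonDyer.BirchSwinnertonDyer.Theorems.SylvesterTwoCMFlip

open WeierstrassCurve Field NumberField IsDedekindDomain Finset
open Literature.NumberTheory.EllipticCurves Literature.NumberTheory.GaloisRepresentations
  Literature.NumberTheory.EllipticCurves.ModularForms
  Literature.NumberTheory.EllipticCurves.HuShuYin2019
  Literature.NumberTheory.EllipticCurves.KolyvaginCocycle
  Literature.NumberTheory.EllipticCurves.RingClassField
  Summit.BirchSwinnertonDyer.BirchSwinnertonDyer.Theorems.SylvesterTwoCMData
  Summit.BirchSwinnertonDyer.Rank1Residual.X11b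
  Summit.BirchSwinnertonDyer.Rank1Residual.X11b.RingClassTower

variable {K : Type} [Field K] [NumberField K]

set_option maxHeartbeats 1600000 in
/-- ★ **THE FLIP WITH MULTIPLES BETWEEN TWO LEVELS** (RESIDUE c v3 l.87–98 for the class TERMS).  Global data as in
`flip_core_sylvesterTower` (`K ∋ ω`, `p`, the frame transport `κ`, two cubic-twist frames `ψ₁ : E₉ ≃ E_{b₁}` with
family `ρ`, `ψ₂ : E₉ ≃ E_{b₂}` with family `ρ' = ρ²`, the `K[9p]`-fixer `N₀` with `hN₀` at `emb₀`, representatives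
`t`); a Kolyvagin prime `ℓ` for `E_{b₂}` at the level `nl = 2^M`; TWO levels — the bottom `Nb = 9pm` (`emb_b, ιe_b,
N_b`, list `l_b`, CM point `y_b`) and the top `Nt = 9p(ℓm)` (`emb_t ⊇ emb_b` coherent, `ιe_t, N_t`, the generator `σ`
of `Gal(K[Nt]/K[Nb])`, a lift `l_b'` of `l_b` to `K[Nt]` (same primes, `σ' ∘ incl = incl ∘ σ`), the full top list
`l_t ~ (σ, ℓ) :: l_b'` pairwise commuting inside `Gal(K[Nt]/K)`, with `Σ_{i≤ℓ} σ^i y_t = 0`, CM point `y_t`);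
the well-formedness of the top class of `ψ₁` (`hA₁, hP₁` w.r.t. `N_t`) and of the bottom class of `ψ₂`
(`hA₂b, hP₂b` w.r.t. `N_b`), admissibility `hA₂` of the top module for `ψ₂`, the bottom class Selmer at `λ`
(`hsel₂b`), good reduction of both twists at `λ ∋ ℓ`.  Then for every `k : ℤ`:
`k • c_t(ψ₁, D_{l_t} y_t) ∈ Sel_λ(E_{b₁}) ↔ k • c_b(ψ₂, D_{l_b} y_b) ∈ T_λ(E_{b₂})`.
[cite: GrossLMS1991, §3 (3.5), Prop. 3.7, Prop. 6.2 (2), §4] [cite: McCallumLMS1991, Prop. 4.4, §4 (4)–(6)]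
[cite: HuShuYin2019, §2 Prop. 2.4, §4.1] [cite: Nekovar2007, Prop. 4.9, Prop. 4.13] -/
theorem pairFlip_core_sylvesterTower {ω : K} (hω : ω ^ 2 + ω + 1 = 0) (h2 : Module.finrank ℚ K = 2)
    (ι : K →+* ℂ) [(⟨0, 0, 1, 0, -1⟩ : WeierstrassCurve ℚ).IsElliptic] [(⟨0, 0, 1, 0, -1⟩ : WeierstrassCurve ℚ).IsGloballyMinimal] (hES2 : Nekovar2007.cmPoint_frobeniusCongruence)
    (Dt : ModularParametrizationData (⟨0, 0, 1, 0, -1⟩ : WeierstrassCurve ℚ) 243)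
    {b₁ b₂ : ℚ} [((cubeSumCurve b₁).baseChange K).IsElliptic] [((cubeSumCurve b₂).baseChange K).IsElliptic]
    [(cubeSumCurve b₂).IsElliptic]
    {p ℓ m Nb Nt : ℕ} (hp : p.Prime) (hp3 : p % 3 = 1) (hℓ : ℓ.Prime) (hℓ3 : ℓ % 3 = 2) (hℓ2 : ℓ ≠ 2)
    (hm : m ≠ 0) (hm3 : ∀ q ∈ m.primeFactors, q % 3 = 2) (hℓm : ¬ ℓ ∣ m)
    (hNb : 9 * p * m = Nb) (hNt : 9 * p * (ℓ * m) = Nt)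
    (hℓ₂ : ¬ ℓ ∣ (cubeSumCurve b₂).conductorNorm ℤ) (hℓdK : ¬ ((ℓ : ℤ) ∣ NumberField.discr K))
    {M : ℕ} (hM : 1 ≤ M) (nl : ℕ) (hn : nl = 2 ^ M) (hFrob₂ : FrobEqFrobInfty (cubeSumCurve b₂) K nl ℓ)
    -- the frame transport `E₉(K̄) ≃+ W₀(K̄)`
    (κ : geomPoints ((cubeSumCurve 9).baseChange K) ≃+ geomPoints ((⟨0, 0, 1, 0, -1⟩ : WeierstrassCurve ℚ).baseChange K))
    (hκG : ∀ (g : absoluteGaloisGroup K) (P : geomPoints ((cubeSumCurve 9).baseChange K)), κ (g • P) = g • κ P)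
    {a b d : AlgebraicClosure K}
    (hκ : ∀ {x y : AlgebraicClosure K}
      (h : (((cubeSumCurve 9).baseChange K).baseChange (AlgebraicClosure K)).toAffine.Nonsingular x y),
      ∃ h', κ (.some x y h) = .some (a * x) (b * y + d) h')
    -- the two cubic-twist frames
    {v₁ v₂ : AlgebraicClosure K} (hv₁ : v₁ ≠ 0) (hv₂ : v₂ ≠ 0)
    (hv₁3 : ∀ g : absoluteGaloisGroup K, ((show AlgebraicClosure K ≃ₐ[K] AlgebraicClosure K from g) v₁) ^ 3 = v₁ ^ 3)
    (hv₂3 : ∀ g : absoluteGaloisGroup K, ((show AlgebraicClosure K ≃ₐ[K] AlgebraicClosure K from g) v₂) ^ 3 = v₂ ^ 3)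
    {ψ₁ : geomPoints ((cubeSumCurve 9).baseChange K) ≃+ geomPoints ((cubeSumCurve b₁).baseChange K)}
    {ψ₂ : geomPoints ((cubeSumCurve 9).baseChange K) ≃+ geomPoints ((cubeSumCurve b₂).baseChange K)}
    (hψ₁ : ∀ {x y : AlgebraicClosure K}
      (h : (((cubeSumCurve 9).baseChange K).baseChange (AlgebraicClosure K)).toAffine.Nonsingular x y),
      ∃ h', ψ₁ (Affine.Point.some x y h) = Affine.Point.some (v₁ ^ 2 * x) (v₁ ^ 3 * y) h')
    (hψ₂ : ∀ {x y : AlgebraicClosure K}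
      (h : (((cubeSumCurve 9).baseChange K).baseChange (AlgebraicClosure K)).toAffine.Nonsingular x y),
      ∃ h', ψ₂ (Affine.Point.some x y h) = Affine.Point.some (v₂ ^ 2 * x) (v₂ ^ 3 * y) h')
    {ρ ρ' : absoluteGaloisGroup K → geomPoints ((cubeSumCurve 9).baseChange K) ≃+ geomPoints ((cubeSumCurve 9).baseChange K)}
    (hρ : ∀ (g : absoluteGaloisGroup K) {x y : AlgebraicClosure K}
        (h : (((cubeSumCurve 9).baseChange K).baseChange (AlgebraicClosure K)).toAffine.Nonsingular x y),
        ∃ h', ρ g (Affine.Point.some x y h) =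
          Affine.Point.some (((show AlgebraicClosure K ≃ₐ[K] AlgebraicClosure K from g) v₁ / v₁) ^ 2 * x) y h')
    (hρ₂ : ∀ (g : absoluteGaloisGroup K) {x y : AlgebraicClosure K}
        (h : (((cubeSumCurve 9).baseChange K).baseChange (AlgebraicClosure K)).toAffine.Nonsingular x y),
        ∃ h', ρ' g (Affine.Point.some x y h) =
          Affine.Point.some (((show AlgebraicClosure K ≃ₐ[K] AlgebraicClosure K from g) v₂ / v₂) ^ 2 * x) y h')
    (hρ' : ∀ (g : absoluteGaloisGroup K) (x : geomPoints ((cubeSumCurve 9).baseChange K)), ρ' g x = ρ g (ρ g x))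
    (hlaw₂ : ∀ (g : absoluteGaloisGroup K) (P : geomPoints ((cubeSumCurve 9).baseChange K)),
        g • ψ₂ P = ψ₂ (ρ' g (g • P)))
    (hρcomm : ∀ (g h : absoluteGaloisGroup K) (P : geomPoints ((cubeSumCurve 9).baseChange K)),
        h • ρ g P = ρ g (h • P))
    -- the bottom embedding `K[9p] → K̄`, its fixer (fixing both cube roots), representatives
    (emb₀ : ringClassField K ι (9 * p) →+* AlgebraicClosure K)
    (N₀ : Subgroup (absoluteGaloisGroup K))
    (hN₀ : ∀ g : absoluteGaloisGroup K, g ∈ N₀ ↔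
      ∀ x : ringClassField K ι (9 * p), (show AlgebraicClosure K ≃ₐ[K] AlgebraicClosure K from g) (emb₀ x) = emb₀ x)
    (hN₀v₁ : ∀ h ∈ N₀, (show AlgebraicClosure K ≃ₐ[K] AlgebraicClosure K from h) v₁ = v₁)
    (hN₀v₂ : ∀ h ∈ N₀, (show AlgebraicClosure K ≃ₐ[K] AlgebraicClosure K from h) v₂ = v₂)
    {ιt : Type} [Fintype ιt] (t : ιt → absoluteGaloisGroup K)
    -- the bottom level `K[Nb]`, `Nb = 9pm`
    (hle₀b : ringClassField K ι (9 * p) ≤ ringClassField K ι Nb)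
    (emb_b : ringClassField K ι Nb →+* AlgebraicClosure K)
    (hemb_b : ∀ k : K, emb_b (algebraMap K (ringClassField K ι Nb) k) = algebraMap K (AlgebraicClosure K) k)
    (hcoh₀b : ∀ x : ringClassField K ι (9 * p), emb_b (RingClassField.inclusion ι hle₀b x) = emb₀ x)
    (ιe_b : letI : DecidableEq (ringClassField K ι Nb) := fun a b ↦ Classical.propDecidable (a = b)
      ((⟨0, 0, 1, 0, -1⟩ : WeierstrassCurve ℚ).baseChange (ringClassField K ι Nb)).toAffine.Point →+ geomPoints ((⟨0, 0, 1, 0, -1⟩ : WeierstrassCurve ℚ).baseChange K))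
    (hιe_b : ∀ P, ιe_b P = Affine.Point.map (W' := (⟨0, 0, 1, 0, -1⟩ : WeierstrassCurve ℚ)) emb_b.toRatAlgHom P)
    (N_b : Subgroup (absoluteGaloisGroup K))
    (hN_b : ∀ g : absoluteGaloisGroup K, g ∈ N_b ↔
      ∀ x : ringClassField K ι Nb, (show AlgebraicClosure K ≃ₐ[K] AlgebraicClosure K from g) (emb_b x) = emb_b x)
    (l_b : List ((ringClassField K ι Nb ≃ₐ[ℚ] ringClassField K ι Nb) × ℕ))
    {y_b : ((⟨0, 0, 1, 0, -1⟩ : WeierstrassCurve ℚ).baseChange (ringClassField K ι Nb)).toAffine.Point}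
    (hy_b : Affine.Point.map (W' := (⟨0, 0, 1, 0, -1⟩ : WeierstrassCurve ℚ)) (ringClassField K ι Nb).subtype.toRatAlgHom y_b =
      Dt.φ (heegnerTau ((m : ℤ) ^ 2 * (81 * ((p : ℤ) ^ 2 + 4 * p + 16)),
        (m : ℤ) * (-(9 * (4 * (p : ℤ) ^ 2 + 17 * p + 72))), 4 * (p : ℤ) ^ 2 + 18 * p + 81)))
    -- the top level `K[Nt]`, `Nt = 9p(ℓm)`, coherent over the bottom one
    (hle_bt : ringClassField K ι Nb ≤ ringClassField K ι Nt)
    (emb_t : ringClassField K ι Nt →+* AlgebraicClosure K)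
    (hemb_t : ∀ k : K, emb_t (algebraMap K (ringClassField K ι Nt) k) = algebraMap K (AlgebraicClosure K) k)
    (hcoh_bt : ∀ x : ringClassField K ι Nb, emb_t (RingClassField.inclusion ι hle_bt x) = emb_b x)
    (ιe_t : letI : DecidableEq (ringClassField K ι Nt) := fun a b ↦ Classical.propDecidable (a = b)
      ((⟨0, 0, 1, 0, -1⟩ : WeierstrassCurve ℚ).baseChange (ringClassField K ι Nt)).toAffine.Point →+ geomPoints ((⟨0, 0, 1, 0, -1⟩ : WeierstrassCurve ℚ).baseChange K))
    (hιe_t : ∀ P, ιe_t P = Affine.Point.map (W' := (⟨0, 0, 1, 0, -1⟩ : WeierstrassCurve ℚ)) emb_t.toRatAlgHom P)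
    (N_t : Subgroup (absoluteGaloisGroup K))
    (hN_t : ∀ g : absoluteGaloisGroup K, g ∈ N_t ↔
      ∀ x : ringClassField K ι Nt, (show AlgebraicClosure K ≃ₐ[K] AlgebraicClosure K from g) (emb_t x) = emb_t x)
    {σ : ringClassField K ι Nt ≃ₐ[ℚ] ringClassField K ι Nt}
    (hσ : Subgroup.zpowers σ = ringClassGalOver ι Nt Nb)
    (l_t l_b' : List ((ringClassField K ι Nt ≃ₐ[ℚ] ringClassField K ι Nt) × ℕ))
    (hperm : l_t.Perm ((σ, ℓ) :: l_b'))
    (hcompat : List.Forall₂ (fun a b ↦ a.2 = b.2 ∧ ∀ x : ringClassField K ι Nb,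
      a.1 (RingClassField.inclusion ι hle_bt x) = RingClassField.inclusion ι hle_bt (b.1 x)) l_b' l_b)
    (hc_t : ∀ a ∈ l_t, ∀ b ∈ l_t, Commute a.1 b.1) (hgal : ∀ a ∈ l_t, a.1 ∈ ringClassGal ι Nt)
    {y_t : ((⟨0, 0, 1, 0, -1⟩ : WeierstrassCurve ℚ).baseChange (ringClassField K ι Nt)).toAffine.Point}
    (hy_t : Affine.Point.map (W' := (⟨0, 0, 1, 0, -1⟩ : WeierstrassCurve ℚ)) (ringClassField K ι Nt).subtype.toRatAlgHom y_t =
      Dt.φ (heegnerTau (((ℓ * m : ℕ) : ℤ) ^ 2 * (81 * ((p : ℤ) ^ 2 + 4 * p + 16)),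
        ((ℓ * m : ℕ) : ℤ) * (-(9 * (4 * (p : ℤ) ^ 2 + 17 * p + 72))), 4 * (p : ℤ) ^ 2 + 18 * p + 81)))
    (htr_t : ∑ i ∈ Finset.range (ℓ + 1), pointGalHom (⟨0, 0, 1, 0, -1⟩ : WeierstrassCurve ℚ) (ringClassField K ι Nt) (σ ^ i) y_t = 0)
    -- the classes' admissibility / invariance inputs
    {hdiv₁ : ∀ P : geomPoints ((cubeSumCurve b₁).baseChange K),
      ∃ R : geomPoints ((cubeSumCurve b₁).baseChange K), ((nl : ℕ) : ℤ) • R = P}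
    {hdiv₂ : ∀ P : geomPoints ((cubeSumCurve b₂).baseChange K),
      ∃ R : geomPoints ((cubeSumCurve b₂).baseChange K), ((nl : ℕ) : ℤ) • R = P}
    (hA₁ : IsAdmissible (absoluteGaloisGroup K)
      ((FixedPoints.addSubgroup N_t (geomPoints ((cubeSumCurve 9).baseChange K))).map ψ₁.toAddMonoidHom) ((nl : ℕ) : ℤ))
    (hA₂ : IsAdmissible (absoluteGaloisGroup K)
      ((FixedPoints.addSubgroup N_t (geomPoints ((cubeSumCurve 9).baseChange K))).map ψ₂.toAddMonoidHom) ((nl : ℕ) : ℤ))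
    (hP₁ : ψ₁ (∑ i, ρ (t i) (t i • κ.symm (ιe_t
        (l_t.foldr (fun c z ↦ KolyvaginOperator.derivOp (pointGalHom (⟨0, 0, 1, 0, -1⟩ : WeierstrassCurve ℚ) (ringClassField K ι Nt)) c.1 c.2 z) y_t)))) ∈
      invPoints (absoluteGaloisGroup K)
        ((FixedPoints.addSubgroup N_t (geomPoints ((cubeSumCurve 9).baseChange K))).map ψ₁.toAddMonoidHom) ((nl : ℕ) : ℤ))
    (hA₂b : IsAdmissible (absoluteGaloisGroup K)
      ((FixedPoints.addSubgroup N_b (geomPoints ((cubeSumCurve 9).baseChange K))).map ψ₂.toAddMonoidHom) ((nl : ℕ) : ℤ))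
    (hP₂b : ψ₂ (∑ i, ρ' (t i) (t i • κ.symm (ιe_b
        (l_b.foldr (fun c z ↦ KolyvaginOperator.derivOp (pointGalHom (⟨0, 0, 1, 0, -1⟩ : WeierstrassCurve ℚ) (ringClassField K ι Nb)) c.1 c.2 z) y_b)))) ∈
      invPoints (absoluteGaloisGroup K)
        ((FixedPoints.addSubgroup N_b (geomPoints ((cubeSumCurve 9).baseChange K))).map ψ₂.toAddMonoidHom) ((nl : ℕ) : ℤ))
    -- the place, good for both twists, and the bottom class Selmer there
    (v : HeightOneSpectrum (𝓞 K)) (hv : (ℓ : 𝓞 K) ∈ v.asIdeal)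
    (hgood₁ : ((cubeSumCurve b₁).baseChange K).HasGoodReductionAt v)
    (hgood₂ : ((cubeSumCurve b₂).baseChange K).HasGoodReductionAt v)
    (hsel₂b : kolyvaginClass ((cubeSumCurve b₂).baseChange K) ((nl : ℕ) : ℤ) hdiv₂ hA₂b
      (ψ₂ (∑ i, ρ' (t i) (t i • κ.symm (ιe_b
        (l_b.foldr (fun c z ↦ KolyvaginOperator.derivOp (pointGalHom (⟨0, 0, 1, 0, -1⟩ : WeierstrassCurve ℚ) (ringClassField K ι Nb)) c.1 c.2 z) y_b))))) hP₂b ∈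
      selmerLocalKer ((cubeSumCurve b₂).baseChange K) (v.adicCompletion K) ((nl : ℕ) : ℤ))
    (k : ℤ) :
    k • kolyvaginClass ((cubeSumCurve b₁).baseChange K) ((nl : ℕ) : ℤ) hdiv₁ hA₁
        (ψ₁ (∑ i, ρ (t i) (t i • κ.symm (ιe_t
          (l_t.foldr (fun c z ↦ KolyvaginOperator.derivOp (pointGalHom (⟨0, 0, 1, 0, -1⟩ : WeierstrassCurve ℚ) (ringClassField K ι Nt)) c.1 c.2 z) y_t))))) hP₁ ∈
        selmerLocalKer ((cubeSumCurve b₁).baseChange K) (v.adicCompletion K) ((nl : ℕ) : ℤ) ↔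
      k • kolyvaginClass ((cubeSumCurve b₂).baseChange K) ((nl : ℕ) : ℤ) hdiv₂ hA₂b
          (ψ₂ (∑ i, ρ' (t i) (t i • κ.symm (ιe_b
            (l_b.foldr (fun c z ↦ KolyvaginOperator.derivOp (pointGalHom (⟨0, 0, 1, 0, -1⟩ : WeierstrassCurve ℚ) (ringClassField K ι Nb)) c.1 c.2 z) y_b))))) hP₂b ∈
        ((cubeSumCurve b₂).baseChange K).torsionLocalKer (v.adicCompletion K) ((nl : ℕ) : ℤ) := by
  subst hNt hNb
  haveI : Fact ℓ.Prime := ⟨hℓ⟩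
  have hK := JZero.isImaginaryQuadratic_of_sq_add_self_add_one hω h2
  have hdK := JZero.discr_eq_neg_three_of_sq_add_self_add_one hω h2
  have hinert := JZero.span_natCast_isPrime_of_mod_three_eq_two hω h2 hℓ hℓ3
  have hp0 : p ≠ 0 := hp.ne_zero
  have hℓ3' : ℓ ≠ 3 := by rintro rfl; norm_num at hℓ3
  have hℓp : ¬ ℓ ∣ p := fun h ↦ by
    have := (Nat.prime_dvd_prime_iff_eq hℓ hp).mp h; subst this; omega
  have hΔ := not_dvd_minimalDiscriminantInt_sylvesterNineMinimal hℓ hℓ3'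
  have hNb0 : 9 * p * m ≠ 0 := mul_ne_zero (mul_ne_zero (by norm_num) hp0) hm
  have hNt0 : 9 * p * (ℓ * m) ≠ 0 := mul_ne_zero (mul_ne_zero (by norm_num) hp0) (mul_ne_zero hℓ.ne_zero hm)
  have hℓNb : ¬ ℓ ∣ 9 * p * m := by
    rw [show 9 * p * m = 3 ^ 2 * (p * m) by ring]
    intro h
    rcases (Nat.Prime.dvd_mul hℓ).mp h with h9 | hpm
    · exact hℓ3' ((Nat.prime_dvd_prime_iff_eq hℓ Nat.prime_three).mp (hℓ.dvd_of_dvd_pow h9))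
    · rcases (Nat.Prime.dvd_mul hℓ).mp hpm with h' | h'
      · exact hℓp h'
      · exact hℓm h'
  -- the fixers: `N_t ≤ N_b`, `N₀` read at the top level
  have hNle : N_t ≤ N_b := fun g hg ↦ (hN_b g).mpr fun x ↦ by rw [← hcoh_bt]; exact (hN_t g).mp hg _
  have hle₀t : ringClassField K ι (9 * p) ≤ ringClassField K ι (9 * p * (ℓ * m)) := hle₀b.trans hle_bt
  have hcoh₀t : ∀ x : ringClassField K ι (9 * p),
      emb_t (RingClassField.inclusion ι hle₀t x) = emb₀ x := fun x ↦ by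
    rw [← hcoh₀b, ← hcoh_bt]
    exact congrArg emb_t (Subtype.ext (by simp only [RingClassField.coe_inclusion]))
  have hN₀t := mem_iff_forall_mem_nine_mul ι hle₀t emb₀ emb_t hcoh₀t hN₀
  have hmapmono : (FixedPoints.addSubgroup N_b (geomPoints ((cubeSumCurve 9).baseChange K))).map ψ₂.toAddMonoidHom ≤
      (FixedPoints.addSubgroup N_t (geomPoints ((cubeSumCurve 9).baseChange K))).map ψ₂.toAddMonoidHom := by
    refine AddSubgroup.map_mono fun x hx ↦ ?_
    rw [JZero.mem_fixedPoints_iff] at hx ⊢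
    exact fun g hg ↦ hx g (hNle hg)
  -- the two points of the core: `z := D_{l_b'} y_t`, `z₀ := (D_{l_b} y_b)↑`
  have e_top : l_t.foldr (fun c z ↦ KolyvaginOperator.derivOp (pointGalHom (⟨0, 0, 1, 0, -1⟩ : WeierstrassCurve ℚ) (ringClassField K ι (9 * p * (ℓ * m)))) c.1 c.2 z) y_t =
      KolyvaginOperator.derivOp (pointGalHom (⟨0, 0, 1, 0, -1⟩ : WeierstrassCurve ℚ) (ringClassField K ι (9 * p * (ℓ * m)))) σ ℓ
        (l_b'.foldr (fun c z ↦ KolyvaginOperator.derivOp (pointGalHom (⟨0, 0, 1, 0, -1⟩ : WeierstrassCurve ℚ) (ringClassField K ι (9 * p * (ℓ * m)))) c.1 c.2 z) y_t) := by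
    rw [foldr_derivOp_perm (⟨0, 0, 1, 0, -1⟩ : WeierstrassCurve ℚ) hperm hc_t y_t, List.foldr_cons]
  have e_bot : ιe_t (Affine.Point.map (W' := (⟨0, 0, 1, 0, -1⟩ : WeierstrassCurve ℚ)) ((RingClassField.inclusion ι hle_bt).restrictScalars ℚ)
      (l_b.foldr (fun c z ↦ KolyvaginOperator.derivOp (pointGalHom (⟨0, 0, 1, 0, -1⟩ : WeierstrassCurve ℚ) (ringClassField K ι (9 * p * m))) c.1 c.2 z) y_b)) =
      ιe_b (l_b.foldr (fun c z ↦ KolyvaginOperator.derivOp (pointGalHom (⟨0, 0, 1, 0, -1⟩ : WeierstrassCurve ℚ) (ringClassField K ι (9 * p * m))) c.1 c.2 z) y_b) := by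
    rw [hιe_t, hιe_b]
    exact map_toRatAlgHom_map_inclusion (W := (⟨0, 0, 1, 0, -1⟩ : WeierstrassCurve ℚ)) ι hle_bt emb_t emb_b hcoh_bt _
  -- `htrz`
  have hmem_b' : ∀ c ∈ l_b', c ∈ l_t := fun c hc ↦ hperm.symm.subset (List.mem_cons_of_mem _ hc)
  have hσt : (σ, ℓ) ∈ l_t := hperm.symm.subset List.mem_cons_self
  have htrz := sum_pointGalHom_pow_foldr_derivOp_eq_zero (⟨0, 0, 1, 0, -1⟩ : WeierstrassCurve ℚ) l_b'
    (fun c hc ↦ hc_t _ hσt _ (hmem_b' c hc)) htr_t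
  -- `hES`: #20 for `(y_t, y_b↑)`, conjugate-wise over `Gal(K[Nt]/K)`, pushed through `D_{l_b'}`
  have hy_b' : Affine.Point.map (W' := (⟨0, 0, 1, 0, -1⟩ : WeierstrassCurve ℚ)) (ringClassField K ι (9 * p * (ℓ * m))).subtype.toRatAlgHom
      (Affine.Point.map (W' := (⟨0, 0, 1, 0, -1⟩ : WeierstrassCurve ℚ)) ((RingClassField.inclusion ι hle_bt).restrictScalars ℚ) y_b) =
      Dt.φ (heegnerTau ((m : ℤ) ^ 2 * (81 * ((p : ℤ) ^ 2 + 4 * p + 16)),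
        (m : ℤ) * (-(9 * (4 * (p : ℤ) ^ 2 + 17 * p + 72))), 4 * (p : ℤ) ^ 2 + 18 * p + 81)) := by
    rw [← hy_b]
    exact map_toRatAlgHom_map_inclusion (W := (⟨0, 0, 1, 0, -1⟩ : WeierstrassCurve ℚ)) ι hle_bt (ringClassField K ι (9 * p * (ℓ * m))).subtype
      (ringClassField K ι (9 * p * m)).subtype (fun x' ↦ RingClassField.coe_inclusion ι hle_bt x') y_b
  have hES : ∀ (φ₀ : absoluteGaloisGroup (ZMod ℓ)), (∀ x : AlgebraicClosure (ZMod ℓ), φ₀ • x = x ^ ℓ) →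
      ∀ g : absoluteGaloisGroup K,
        geomReduction hΔ ((RatClosure.pointsEquiv (K := K) (⟨0, 0, 1, 0, -1⟩ : WeierstrassCurve ℚ)).symm (g • ιe_t
          (l_b'.foldr (fun c z ↦ KolyvaginOperator.derivOp (pointGalHom (⟨0, 0, 1, 0, -1⟩ : WeierstrassCurve ℚ) (ringClassField K ι (9 * p * (ℓ * m)))) c.1 c.2 z) y_t))) =
          φ₀ • geomReduction hΔ ((RatClosure.pointsEquiv (K := K) (⟨0, 0, 1, 0, -1⟩ : WeierstrassCurve ℚ)).symm (g • ιe_t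
            (l_b'.foldr (fun c z ↦ KolyvaginOperator.derivOp (pointGalHom (⟨0, 0, 1, 0, -1⟩ : WeierstrassCurve ℚ) (ringClassField K ι (9 * p * (ℓ * m)))) c.1 c.2 z)
              (Affine.Point.map (W' := (⟨0, 0, 1, 0, -1⟩ : WeierstrassCurve ℚ)) ((RingClassField.inclusion ι hle_bt).restrictScalars ℚ) y_b)))) := by
    intro φ₀ hφ₀ g
    have hred : ∀ x, ((geomReduction hΔ).comp (RatClosure.pointsEquiv (K := K) (⟨0, 0, 1, 0, -1⟩ : WeierstrassCurve ℚ)).symm.toAddMonoidHom) x =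
        geomReduction hΔ ((RatClosure.pointsEquiv (K := K) (⟨0, 0, 1, 0, -1⟩ : WeierstrassCurve ℚ)).symm x) := fun _ ↦ rfl
    have h1 : ∀ P : ((⟨0, 0, 1, 0, -1⟩ : WeierstrassCurve ℚ).baseChange (ringClassField K ι (9 * p * (ℓ * m)))).toAffine.Point,
        pointGalHom (⟨0, 0, 1, 0, -1⟩ : WeierstrassCurve ℚ) (ringClassField K ι (9 * p * (ℓ * m))) 1 P = P := fun P ↦ by
      rw [map_one]; rfl
    have hadd : ∀ P Q : ((⟨0, 0, 1, 0, -1⟩ : WeierstrassCurve ℚ).baseChange (ringClassField K ι (9 * p * (ℓ * m)))).toAffine.Point,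
        ιe_t (P + Q) = ιe_t P + ιe_t Q := fun P Q ↦ by
      rw [hιe_t, hιe_t, hιe_t]
      exact map_add _ P Q
    have hpush := forall_geomReduction_foldr_of_forall (⟨0, 0, 1, 0, -1⟩ : WeierstrassCurve ℚ) φ₀ (fun b c ↦ smul_add φ₀ b c) (smul_zero φ₀)
      ιe_t (map_zero ιe_t) hadd
      ((geomReduction hΔ).comp (RatClosure.pointsEquiv (K := K) (⟨0, 0, 1, 0, -1⟩ : WeierstrassCurve ℚ)).symm.toAddMonoidHom)
      (ringClassGal ι (9 * p * (ℓ * m)) : Set _) l_b'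
      (fun γ hγ c hc k ↦ (ringClassGal ι _).mul_mem ((ringClassGal ι _).pow_mem (hgal c (hmem_b' c hc)) k) hγ)
      (fun γ hγ c hc ↦ commute_of_mem_ringClassGal hK hNt0 hγ (hgal c (hmem_b' c hc)))
      (y := y_t) (y₀ := Affine.Point.map (W' := (⟨0, 0, 1, 0, -1⟩ : WeierstrassCurve ℚ)) ((RingClassField.inclusion ι hle_bt).restrictScalars ℚ) y_b)
      (fun γ _ g ↦ by
        rw [hred, hred]
        exact geomReduction_eq_frob_smul_of_level hES2 hK hdK ι Dt rfl hp3 hm hm3 hℓ2 hℓ3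
          (fun h ↦ by rcases (Nat.Prime.dvd_mul hℓ).mp h with h | h <;> [exact hℓp h; exact hℓm h]) hinert
          hy_t hy_b' emb_t ιe_t hιe_t hΔ hφ₀ g γ) 1 (ringClassGal ι _).one_mem g
    rw [hred, hred, h1, h1] at hpush
    exact hpush
  -- the top class point and the bottom point read at the top module
  have hP₁' : ψ₁ (∑ i, ρ (t i) (t i • κ.symm (ιe_t (KolyvaginOperator.derivOp (pointGalHom (⟨0, 0, 1, 0, -1⟩ : WeierstrassCurve ℚ) (ringClassField K ι (9 * p * (ℓ * m)))) σ ℓ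
      (l_b'.foldr (fun c z ↦ KolyvaginOperator.derivOp (pointGalHom (⟨0, 0, 1, 0, -1⟩ : WeierstrassCurve ℚ) (ringClassField K ι (9 * p * (ℓ * m)))) c.1 c.2 z) y_t))))) ∈
      invPoints (absoluteGaloisGroup K)
        ((FixedPoints.addSubgroup N_t (geomPoints ((cubeSumCurve 9).baseChange K))).map ψ₁.toAddMonoidHom) ((nl : ℕ) : ℤ) := by
    rw [← e_top]; exact hP₁
  have hP₂t : ψ₂ (∑ i, ρ' (t i) (t i • κ.symm (ιe_t (l_b'.foldr
      (fun c z ↦ KolyvaginOperator.derivOp (pointGalHom (⟨0, 0, 1, 0, -1⟩ : WeierstrassCurve ℚ) (ringClassField K ι (9 * p * (ℓ * m)))) c.1 c.2 z)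
        (Affine.Point.map (W' := (⟨0, 0, 1, 0, -1⟩ : WeierstrassCurve ℚ)) ((RingClassField.inclusion ι hle_bt).restrictScalars ℚ) y_b))))) ∈
      invPoints (absoluteGaloisGroup K)
        ((FixedPoints.addSubgroup N_t (geomPoints ((cubeSumCurve 9).baseChange K))).map ψ₂.toAddMonoidHom) ((nl : ℕ) : ℤ) := by
    rw [foldr_derivOp_map_inclusion ι hle_bt hcompat, e_bot]
    exact invPoints_mono hmapmono _ hP₂b
  -- class equality: the bottom class read at the top module IS the bottom class
  have hcls : kolyvaginClass ((cubeSumCurve b₂).baseChange K) ((nl : ℕ) : ℤ) hdiv₂ hA₂ _ hP₂t =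
      kolyvaginClass ((cubeSumCurve b₂).baseChange K) ((nl : ℕ) : ℤ) hdiv₂ hA₂b _ hP₂b := by
    have key : ∀ {P : geomPoints ((cubeSumCurve b₂).baseChange K)}
        (hP : P ∈ invPoints (absoluteGaloisGroup K)
          ((FixedPoints.addSubgroup N_t (geomPoints ((cubeSumCurve 9).baseChange K))).map ψ₂.toAddMonoidHom) ((nl : ℕ) : ℤ))
        (e : P = ψ₂ (∑ i, ρ' (t i) (t i • κ.symm (ιe_b
          (l_b.foldr (fun c z ↦ KolyvaginOperator.derivOp (pointGalHom (⟨0, 0, 1, 0, -1⟩ : WeierstrassCurve ℚ) (ringClassField K ι (9 * p * m))) c.1 c.2 z) y_b))))),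
        kolyvaginClass ((cubeSumCurve b₂).baseChange K) ((nl : ℕ) : ℤ) hdiv₂ hA₂ P hP =
          kolyvaginClass ((cubeSumCurve b₂).baseChange K) ((nl : ℕ) : ℤ) hdiv₂ hA₂b _ hP₂b := by
      intro P hP e; subst e; exact (kolyvaginClass_mono hA₂b hA₂ hmapmono hP₂b hP).symm
    exact key hP₂t (by rw [foldr_derivOp_map_inclusion ι hle_bt hcompat, e_bot])
  have hsel₂ : kolyvaginClass ((cubeSumCurve b₂).baseChange K) ((nl : ℕ) : ℤ) hdiv₂ hA₂ _ hP₂t ∈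
      selmerLocalKer ((cubeSumCurve b₂).baseChange K) (v.adicCompletion K) ((nl : ℕ) : ℤ) := by
    rw [hcls]; exact hsel₂b
  -- `hPmFrob` ((T11) at the bottom level `Nb`, `ℓ ∤ Nb`)
  have hPmFrob : ∀ 𝔓 ∈ v.primesAbove, ∀ F : absoluteGaloisGroup K, IsArithFrobAt (𝓞 K) F 𝔓 →
      F • κ.symm (ιe_t (l_b'.foldr
        (fun c z ↦ KolyvaginOperator.derivOp (pointGalHom (⟨0, 0, 1, 0, -1⟩ : WeierstrassCurve ℚ) (ringClassField K ι (9 * p * (ℓ * m)))) c.1 c.2 z)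
          (Affine.Point.map (W' := (⟨0, 0, 1, 0, -1⟩ : WeierstrassCurve ℚ)) ((RingClassField.inclusion ι hle_bt).restrictScalars ℚ) y_b))) =
        κ.symm (ιe_t (l_b'.foldr
          (fun c z ↦ KolyvaginOperator.derivOp (pointGalHom (⟨0, 0, 1, 0, -1⟩ : WeierstrassCurve ℚ) (ringClassField K ι (9 * p * (ℓ * m)))) c.1 c.2 z)
            (Affine.Point.map (W' := (⟨0, 0, 1, 0, -1⟩ : WeierstrassCurve ℚ)) ((RingClassField.inclusion ι hle_bt).restrictScalars ℚ) y_b))) := by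
    intro 𝔓 h𝔓 F hF
    exact smul_frame_symm_eq_self_of_isArithFrobAt hω h2 ι hNb0 hℓ hℓ3 hℓNb κ hκG emb_b hemb_b ιe_b hιe_b
      (by rw [foldr_derivOp_map_inclusion ι hle_bt hcompat, e_bot]) hv h𝔓 hF
  -- the core
  have hflip := flip_core_sylvesterTower hω h2 ι hp hℓ3 hℓ2 hℓp hm hℓm hℓ₂ hℓdK hM nl hn hFrob₂ hΔ κ hκG hκ
    hv₁ hv₂ hv₁3 hv₂3 hψ₁ hψ₂ hρ hρ₂ hρ' hlaw₂ hρcomm emb_t hemb_t ιe_t hιe_t N_t hN_t N₀ hN₀t hN₀v₁ hN₀v₂ t hσ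
    htrz hES (hdiv₁ := hdiv₁) (hdiv₂ := hdiv₂) hA₁ hA₂ hP₁' hP₂t v hv hgood₁ hgood₂ hPmFrob hsel₂ k
  -- read both sides back on the rows' class terms
  have key₁ : ∀ {P : geomPoints ((cubeSumCurve b₁).baseChange K)}
      (hP : P ∈ invPoints (absoluteGaloisGroup K)
        ((FixedPoints.addSubgroup N_t (geomPoints ((cubeSumCurve 9).baseChange K))).map ψ₁.toAddMonoidHom) ((nl : ℕ) : ℤ))
      (e : P = ψ₁ (∑ i, ρ (t i) (t i • κ.symm (ιe_t
        (l_t.foldr (fun c z ↦ KolyvaginOperator.derivOp (pointGalHom (⟨0, 0, 1, 0, -1⟩ : WeierstrassCurve ℚ) (ringClassField K ι (9 * p * (ℓ * m)))) c.1 c.2 z) y_t))))),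
      kolyvaginClass ((cubeSumCurve b₁).baseChange K) ((nl : ℕ) : ℤ) hdiv₁ hA₁ P hP =
        kolyvaginClass ((cubeSumCurve b₁).baseChange K) ((nl : ℕ) : ℤ) hdiv₁ hA₁ _ hP₁ := by
    intro P hP e; subst e; rfl
  rw [key₁ hP₁' (by rw [← e_top]), hcls] at hflip
  exact hflip

end Summit.BirchSwinnertonDyer.BirchSwinnertonDyer.Theorems.SylvesterTwoCMFlip

end
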